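import Mathlib
import HarnessLib
import Summits.Ventures.LatticeQCDFlow.Exactness.TorusLinkEntropyFloor
import Summits.Ventures.LatticeQCDFlow.Exactness.TorusSublatticeLinks
import Summits.Ventures.LatticeQCDFlow.Exactness.EntropyFloorTailAbsorption

/-!
# The barrier in closed form: for the link-transported CP(N−1)/O(N) coupling on `(ℤ/L)^ν`, `L = s·q ≥ 4`, `s ≥ 2m+4`, and every small flow time, `KL((Φ_{0→c})_*π̄ ‖ e^{−cS}π̄/Z_c) ≥ q^ν·κ⁴c⁴/(4(d−1)d²(d+2)) − L^ν·(48ν²κ²/(d−1))·c²·2e^{Kc}(Kc)^{m+1}/(m+1)!` — LINEAR IN THE VOLUME `L^ν = s^ν·q^ν`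

HONEST FRAMING: exact (Metropolis-corrected) sampling algorithms for lattice gauge theory;
figures of merit are autocorrelation/cost numbers at stated couplings and volumes; no
continuum-physics claim.

Venture `LatticeQCDFlow` (cell pub-lqcd), topic `Exactness`; FANOUT row 7 (`s0-cpn-null`: the
S0-D1 rung — 2D CP⁹ on periodic `L × L` lattices, Lüscher's leading-order trivializing map inside HMC,
Engel–Schaefer 2011).  NEW WORK of the cell over this lineage's `Exactness/TorusLinkEntropyFloor.lean`
(the floor for the model of record given any box-apart family of links) and
`Exactness/TorusSublatticeLinks.lean` (the sublattice family `(s·a, e_{i₀})`, `a ∈ Fin q^ν`, is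
box-apart for `s ≥ 2m+4`, `L = s·q`); nothing is cited as a fact.  Printed counterparts, NAMED ONLY:
Engel–Schaefer, Comput. Phys. Commun. 182 (2011) 2107, §3 eqs. (14)–(17); M. Lüscher, Commun. Math.
Phys. 293 (2010) 899, §3–§4; Abbott et al., Phys. Rev. D 106 (2022) 074506, §V item 4 ("for fixed
models, quality scales exponentially in volume") — for the EXACT LEADING-ORDER TRIVIALIZING FLOW this
is now a theorem with every constant explicit and NO hypothesis beyond the data `(ν, L = s·q ≥ 4,
s ≥ 2m+4, κ, d = dim E ≥ 2, arbitrary link isometries R)` and three volume-free smallness conditions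
on the flow time `c`: the reverse relative entropy of the push-forward of the a-priori measure under
the exact LO flow to the target `e^{−cS}π̄/Z_c` is at least
`q^ν·32κ⁴c⁴/(128(d−1)d²(d+2)) − L^ν·(12κ²(2ν)²/(d−1))c²·2e^{Kc}(Kc)^{m+1}/(m+1)!`, `K = 6|κ|ν/(d−1)`,
i.e. `L^ν·(κ⁴c⁴/(4(d−1)d²(d+2)s^ν) − O(c^{m+3}))`: positive and PROPORTIONAL TO THE VOLUME for every
fixed sufficiently small `c` once `m ≥ 2`.  This closes the barrier direction opened in GEN-16
(ceiling `|Λ|D²/8`) and GEN-17 (abstract block floor).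

## Content

* **`torusLink_sublattice_sub_le_klDiv_map_loFlow`** — the displayed inequality.

NOT CLAIMED: the optimal constants or the optimal trade-off in `(s, m, c)`; `L ≤ 3` or `s ∤ L`; any
statement about ESS, acceptance or autocorrelations of the Metropolis-corrected chain (the floor is for
the reverse relative entropy — the training objective of flow samplers); the rung's numbers.

## Part II (merged here from the staged file `TorusSublatticeEntropyFloorMonomial.lean`, same lineage)

### The barrier as one monomial: `KL((Φ_{0→c})_*π̄ ‖ e^{−cS}π̄/Z_c) ≥ q^ν·κ⁴c⁴/(8(d−1)d²(d+2)) = L^ν·κ⁴c⁴/(8(d−1)d²(d+2)·s^ν)` for the link-transported CP(N−1)/O(N) coupling on `(ℤ/L)^ν`, `L = s·q ≥ 4`, `s ≥ 2m+4`, `m ≥ 2`, and every flow time below four explicit volume-free thresholds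

HONEST FRAMING: exact (Metropolis-corrected) sampling algorithms for lattice gauge theory;
figures of merit are autocorrelation/cost numbers at stated couplings and volumes; no
continuum-physics claim.

Venture `LatticeQCDFlow` (cell pub-lqcd), topic `Exactness`; FANOUT row 7 (`s0-cpn-null`).  NEW WORK of
the cell over Part I of this file (the closed-form floor
`q^ν·A·c⁴/128 − L^ν·tail`) and `Exactness/EntropyFloorTailAbsorption.lean` (the tail is at most half the
block term for `m ≥ 2`, `Kc ≤ 1`, `c ≤ A/(1024e·μK³s^ν)`); nothing is cited as a fact.  Printed
counterparts, NAMED ONLY: Engel–Schaefer 2011 §3; Lüscher 2010; Abbott et al. 2022 §V item 4.  THE LAST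
LINE OF THE BARRIER DIRECTION: a single positive monomial, `q^ν·32κ⁴c⁴/(256(d−1)d²(d+2))`, proportional to
the volume `L^ν = s^ν q^ν`, bounds the reverse relative entropy of the exact leading-order trivializing
flow sampler from below at every flow time `c` under the volume-free conditions `4I₀²ρ²c² ≤ A/16`,
`I₀μc² ≤ 1`, `Ac⁴ ≤ 64`, `Kc ≤ 1`, `c ≤ A/(1024e·μK³s^ν)` (`A = 32κ⁴/((d−1)d²(d+2))`, `μ = 4ν²κ²/(d−1)`,
`K = 6|κ|ν/(d−1)`, `ρ = 32|κ|³ν³/(d−1)²`, `I₀ = 2(2m+3)^ν`).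

## Content

* **`torusLink_sublattice_pow_four_le_klDiv_map_loFlow`** — the displayed inequality;
* **`torusLink_sublattice_klDiv_two_sided`** — with GEN-16's ceiling `|Λ|D²/8`: THE TWO-SIDED VOLUME
  LAW `q^ν·32κ⁴c⁴/(256(d−1)d²(d+2)) ≤ KL ≤ L^ν·(12κ²(2ν)²c²e^{Kc}/(d−1))²/8`.

NOT CLAIMED: optimal constants; `L ≤ 3`, `s ∤ L`, `m ≤ 1`; ESS / acceptance / autocorrelations of the
Metropolis-corrected chain; numbers.
-/

noncomputable section

namespace Summit.Ventures.LatticeQCDFlow.Exactness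

open Function Set Metric MeasureTheory NormedSpace InnerProductSpace InformationTheory
  Literature.MathematicalPhysics.QuantumFieldTheory
open scoped RealInnerProductSpace Topology Nat Classical

variable {ν L : ℕ} [NeZero L] {E : Type*} [NormedAddCommGroup E] [InnerProductSpace ℝ E]
  [FiniteDimensional ℝ E] [MeasurableSpace E] [BorelSpace E] [Nontrivial E] {T : ℝ}

/-- **THE BARRIER IN CLOSED FORM.**  Link-transported CP(N−1)/O(N) coupling on `(ℤ/L)^ν` with arbitrary
link isometries, `L = s·q ≥ 4`, `s ≥ 2m+4`, a direction `i₀`, `d = dim E ≥ 2`, and a flow time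
`0 ≤ c ≤ |T| + 1` satisfying the three smallness conditions (`υ = 2ν`, `β₀ = 1`, `I₀ = 2(2m+3)^ν`,
`n₀ = 1`).  Then `q^ν·32κ⁴c⁴/(128(d−1)d²(d+2)) − L^ν·(12κ²(2ν)²/(d−1))c²·2e^{Kc}(Kc)^{m+1}/(m+1)! ≤
KL((Φ_{0→c})_*π̄ ‖ π̄.tilted(−cS))`, `K = 3|κ|(2ν)/(d−1)`. -/
theorem torusLink_sublattice_sub_le_klDiv_map_loFlow {s q : ℕ} (hL : 4 ≤ L) (hLsq : L = s * q)
    (R : Site ν L × Fin ν → (E ≃ₗᵢ[ℝ] E))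
    (hd : 2 ≤ Module.finrank ℝ E) (κ S₀ : ℝ)
    {c : ℝ} (hc0 : 0 ≤ c) (hc : c ≤ |T| + 1) {e : Site ν L → E} (he : ∀ n, ‖e n‖ = 1) (m : ℕ)
    {g : Site ν L → (Site ν L → sphere (0 : E) 1) → ℝ}
    (hg : ∀ n ω, g n ω = -∫ u in (0 : ℝ)..c, u * (2 * κ ^ 2 / ((Module.finrank ℝ E : ℝ) - 1) *
      ‖tangentKick (localField (linkCoupling (fun ℓ : Site ν L × Fin ν => ℓ.1) (fun ℓ => ℓ.1.shift ℓ.2) R) n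
        (sphereTDFlow (G := fun _ : ℝ => loFlowAction κ S₀
          (linkCoupling (fun ℓ : Site ν L × Fin ν => ℓ.1) (fun ℓ => ℓ.1.shift ℓ.2) R))
          (contDiff_const_family (contDiff_loFlowAction
            (linkCoupling (fun ℓ : Site ν L × Fin ν => ℓ.1) (fun ℓ => ℓ.1.shift ℓ.2) R) κ S₀)) T 0 u
          ((nball (fun k => insert k (couplingNbhd
            (linkCoupling (fun ℓ : Site ν L × Fin ν => ℓ.1) (fun ℓ => ℓ.1.shift ℓ.2) R) k)) (m + 1) n).piecewise
            (fun i => ((ω i : sphere (0 : E) 1) : E)) e)))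
        (sphereTDFlow (G := fun _ : ℝ => loFlowAction κ S₀
          (linkCoupling (fun ℓ : Site ν L × Fin ν => ℓ.1) (fun ℓ => ℓ.1.shift ℓ.2) R))
          (contDiff_const_family (contDiff_loFlowAction
            (linkCoupling (fun ℓ : Site ν L × Fin ν => ℓ.1) (fun ℓ => ℓ.1.shift ℓ.2) R) κ S₀)) T 0 u
          ((nball (fun k => insert k (couplingNbhd
            (linkCoupling (fun ℓ : Site ν L × Fin ν => ℓ.1) (fun ℓ => ℓ.1.shift ℓ.2) R) k)) (m + 1) n).piecewise
            (fun i => ((ω i : sphere (0 : E) 1) : E)) e) n)‖ ^ 2))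
    (i₀ : Fin ν) (hs : m + 1 + (m + 1) + 2 ≤ s)
    (hc1 : 4 * (2 * (2 * ((m : ℝ) + 1) + 1) ^ ν) ^ 2 *
        (4 * |κ| ^ 3 * (2 * (ν : ℝ)) ^ 3 / ((Module.finrank ℝ E : ℝ) - 1) ^ 2) ^ 2 * c ^ 2 ≤
      32 * κ ^ 4 /
        (((Module.finrank ℝ E : ℝ) - 1) * (Module.finrank ℝ E : ℝ) ^ 2 * ((Module.finrank ℝ E : ℝ) + 2)) / 16)
    (hc2 : (2 * (2 * ((m : ℝ) + 1) + 1) ^ ν) * (κ ^ 2 * (2 * (ν : ℝ)) ^ 2 / ((Module.finrank ℝ E : ℝ) - 1)) *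
      c ^ 2 ≤ 1)
    (hc3 : 32 * κ ^ 4 /
        (((Module.finrank ℝ E : ℝ) - 1) * (Module.finrank ℝ E : ℝ) ^ 2 * ((Module.finrank ℝ E : ℝ) + 2)) *
      c ^ 4 ≤ 64) :
    (q : ℝ) ^ ν * (32 * κ ^ 4 /
          (((Module.finrank ℝ E : ℝ) - 1) * (Module.finrank ℝ E : ℝ) ^ 2 * ((Module.finrank ℝ E : ℝ) + 2)) *
        c ^ 4 / 128) -
      (L : ℝ) ^ ν *
        (12 * κ ^ 2 * (2 * (ν : ℝ)) ^ 2 / ((Module.finrank ℝ E : ℝ) - 1) * c ^ 2 *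
        (2 * Real.exp (3 * |κ| * (2 * (ν : ℝ)) / ((Module.finrank ℝ E : ℝ) - 1) * c) *
          (3 * |κ| * (2 * (ν : ℝ)) / ((Module.finrank ℝ E : ℝ) - 1) * c) ^ (m + 1) / ((m + 1)! : ℝ))) ≤
      (klDiv (Measure.map (sphereTDFlowMap (G := fun _ : ℝ => loFlowAction κ S₀
          (linkCoupling (fun ℓ : Site ν L × Fin ν => ℓ.1) (fun ℓ => ℓ.1.shift ℓ.2) R))
          (contDiff_const_family (contDiff_loFlowAction
            (linkCoupling (fun ℓ : Site ν L × Fin ν => ℓ.1) (fun ℓ => ℓ.1.shift ℓ.2) R) κ S₀)) T 0 c)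
          (Measure.pi (fun _ : Site ν L => uniformSphere (volume : Measure E))))
        ((Measure.pi (fun _ : Site ν L => uniformSphere (volume : Measure E))).tilted
          fun ω => -(c * esAction κ S₀
            (linkCoupling (fun ℓ : Site ν L × Fin ν => ℓ.1) (fun ℓ => ℓ.1.shift ℓ.2) R) (fun m => (ω m : E))))).toReal := by
  have h := torusLink_pairs_sub_le_klDiv_map_loFlow (ν := ν) (L := L) hL R hd κ S₀ hc0 hc he m hg
    (Finset.univ : Finset (Fin ν → Fin q))
    (fun a : Fin ν → Fin q => fun i => (((s * (a i : ℕ) : ℕ) : ℤ) : ZMod L)) (fun _ => i₀)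
    (fun a _ a' _ haa => torus_sublattice_links_box_apart hLsq hs i₀ haa) hc1 hc2 hc3 (T := T)
  have e1 : ((Finset.univ : Finset (Fin ν → Fin q)).card : ℝ) = (q : ℝ) ^ ν := by
    rw [Finset.card_univ, Fintype.card_fun, Fintype.card_fin, Fintype.card_fin]; push_cast; rfl
  have e2 : (Fintype.card (Site ν L) : ℝ) = (L : ℝ) ^ ν := by
    rw [Fintype.card_fun, ZMod.card, Fintype.card_fin]; push_cast; rfl
  rw [e1, e2] at h
  exact h

/-- **THE BARRIER AS ONE MONOMIAL**: under the hypotheses of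
`torusLink_sublattice_sub_le_klDiv_map_loFlow` plus `m ≥ 2`, `Kc ≤ 1` and `c ≤ A/(1024e·μK³s^ν)`:
`q^ν·32κ⁴c⁴/(256(d−1)d²(d+2)) ≤ KL((Φ_{0→c})_*π̄ ‖ π̄.tilted(−cS))`. -/
theorem torusLink_sublattice_pow_four_le_klDiv_map_loFlow {s q : ℕ} (hL : 4 ≤ L) (hLsq : L = s * q)
    (R : Site ν L × Fin ν → (E ≃ₗᵢ[ℝ] E))
    (hd : 2 ≤ Module.finrank ℝ E) (κ S₀ : ℝ)
    {c : ℝ} (hc0 : 0 ≤ c) (hc : c ≤ |T| + 1) {e : Site ν L → E} (he : ∀ n, ‖e n‖ = 1) (m : ℕ)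
    {g : Site ν L → (Site ν L → sphere (0 : E) 1) → ℝ}
    (hg : ∀ n ω, g n ω = -∫ u in (0 : ℝ)..c, u * (2 * κ ^ 2 / ((Module.finrank ℝ E : ℝ) - 1) *
      ‖tangentKick (localField (linkCoupling (fun ℓ : Site ν L × Fin ν => ℓ.1) (fun ℓ => ℓ.1.shift ℓ.2) R) n
        (sphereTDFlow (G := fun _ : ℝ => loFlowAction κ S₀
          (linkCoupling (fun ℓ : Site ν L × Fin ν => ℓ.1) (fun ℓ => ℓ.1.shift ℓ.2) R))
          (contDiff_const_family (contDiff_loFlowAction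
            (linkCoupling (fun ℓ : Site ν L × Fin ν => ℓ.1) (fun ℓ => ℓ.1.shift ℓ.2) R) κ S₀)) T 0 u
          ((nball (fun k => insert k (couplingNbhd
            (linkCoupling (fun ℓ : Site ν L × Fin ν => ℓ.1) (fun ℓ => ℓ.1.shift ℓ.2) R) k)) (m + 1) n).piecewise
            (fun i => ((ω i : sphere (0 : E) 1) : E)) e)))
        (sphereTDFlow (G := fun _ : ℝ => loFlowAction κ S₀
          (linkCoupling (fun ℓ : Site ν L × Fin ν => ℓ.1) (fun ℓ => ℓ.1.shift ℓ.2) R))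
          (contDiff_const_family (contDiff_loFlowAction
            (linkCoupling (fun ℓ : Site ν L × Fin ν => ℓ.1) (fun ℓ => ℓ.1.shift ℓ.2) R) κ S₀)) T 0 u
          ((nball (fun k => insert k (couplingNbhd
            (linkCoupling (fun ℓ : Site ν L × Fin ν => ℓ.1) (fun ℓ => ℓ.1.shift ℓ.2) R) k)) (m + 1) n).piecewise
            (fun i => ((ω i : sphere (0 : E) 1) : E)) e) n)‖ ^ 2))
    (i₀ : Fin ν) (hs2 : m + 1 + (m + 1) + 2 ≤ s)
    (hc1 : 4 * (2 * (2 * ((m : ℝ) + 1) + 1) ^ ν) ^ 2 *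
        (4 * |κ| ^ 3 * (2 * (ν : ℝ)) ^ 3 / ((Module.finrank ℝ E : ℝ) - 1) ^ 2) ^ 2 * c ^ 2 ≤
      32 * κ ^ 4 /
        (((Module.finrank ℝ E : ℝ) - 1) * (Module.finrank ℝ E : ℝ) ^ 2 * ((Module.finrank ℝ E : ℝ) + 2)) / 16)
    (hc2 : (2 * (2 * ((m : ℝ) + 1) + 1) ^ ν) * (κ ^ 2 * (2 * (ν : ℝ)) ^ 2 / ((Module.finrank ℝ E : ℝ) - 1)) *
      c ^ 2 ≤ 1)
    (hc3 : 32 * κ ^ 4 /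
        (((Module.finrank ℝ E : ℝ) - 1) * (Module.finrank ℝ E : ℝ) ^ 2 * ((Module.finrank ℝ E : ℝ) + 2)) *
      c ^ 4 ≤ 64)
    (hm : 2 ≤ m) (hKc : 3 * |κ| * (2 * (ν : ℝ)) / ((Module.finrank ℝ E : ℝ) - 1) * c ≤ 1)
    (hcA : c ≤ (32 * κ ^ 4 /
        (((Module.finrank ℝ E : ℝ) - 1) * (Module.finrank ℝ E : ℝ) ^ 2 * ((Module.finrank ℝ E : ℝ) + 2))) /
      (1024 * Real.exp 1 * (κ ^ 2 * (2 * (ν : ℝ)) ^ 2 / ((Module.finrank ℝ E : ℝ) - 1)) *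
        (3 * |κ| * (2 * (ν : ℝ)) / ((Module.finrank ℝ E : ℝ) - 1)) ^ 3 * (s : ℝ) ^ ν)) :
    (q : ℝ) ^ ν * (32 * κ ^ 4 /
          (((Module.finrank ℝ E : ℝ) - 1) * (Module.finrank ℝ E : ℝ) ^ 2 * ((Module.finrank ℝ E : ℝ) + 2))) *
        c ^ 4 / 256 ≤
      (klDiv (Measure.map (sphereTDFlowMap (G := fun _ : ℝ => loFlowAction κ S₀
          (linkCoupling (fun ℓ : Site ν L × Fin ν => ℓ.1) (fun ℓ => ℓ.1.shift ℓ.2) R))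
          (contDiff_const_family (contDiff_loFlowAction
            (linkCoupling (fun ℓ : Site ν L × Fin ν => ℓ.1) (fun ℓ => ℓ.1.shift ℓ.2) R) κ S₀)) T 0 c)
          (Measure.pi (fun _ : Site ν L => uniformSphere (volume : Measure E))))
        ((Measure.pi (fun _ : Site ν L => uniformSphere (volume : Measure E))).tilted
          fun ω => -(c * esAction κ S₀
            (linkCoupling (fun ℓ : Site ν L × Fin ν => ℓ.1) (fun ℓ => ℓ.1.shift ℓ.2) R) (fun m => (ω m : E))))).toReal := by
  have hd1 : (0 : ℝ) < (Module.finrank ℝ E : ℝ) - 1 := by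
    have : (2 : ℝ) ≤ Module.finrank ℝ E := by exact_mod_cast hd
    linarith
  have hs : 0 < s := by omega
  have h := torusLink_sublattice_sub_le_klDiv_map_loFlow (ν := ν) (L := L) hL hLsq R hd κ S₀ hc0 hc he m hg i₀ hs2
    hc1 hc2 hc3 (T := T)
  have htail := half_blockTerm_le_sub_coneTail (ν := ν) hLsq hs hm
    (μ := κ ^ 2 * (2 * (ν : ℝ)) ^ 2 / ((Module.finrank ℝ E : ℝ) - 1))
    (K := 3 * |κ| * (2 * (ν : ℝ)) / ((Module.finrank ℝ E : ℝ) - 1))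
    (A := 32 * κ ^ 4 /
      (((Module.finrank ℝ E : ℝ) - 1) * (Module.finrank ℝ E : ℝ) ^ 2 * ((Module.finrank ℝ E : ℝ) + 2)))
    (by positivity) (by positivity) (by positivity) hc0 hKc hcA
  have e : (L : ℝ) ^ ν * (12 * (κ ^ 2 * (2 * (ν : ℝ)) ^ 2 / ((Module.finrank ℝ E : ℝ) - 1)) * c ^ 2 *
      (2 * Real.exp (3 * |κ| * (2 * (ν : ℝ)) / ((Module.finrank ℝ E : ℝ) - 1) * c) *
        (3 * |κ| * (2 * (ν : ℝ)) / ((Module.finrank ℝ E : ℝ) - 1) * c) ^ (m + 1) / ((m + 1).factorial : ℝ))) =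
      (L : ℝ) ^ ν * (12 * κ ^ 2 * (2 * (ν : ℝ)) ^ 2 / ((Module.finrank ℝ E : ℝ) - 1) * c ^ 2 *
      (2 * Real.exp (3 * |κ| * (2 * (ν : ℝ)) / ((Module.finrank ℝ E : ℝ) - 1) * c) *
        (3 * |κ| * (2 * (ν : ℝ)) / ((Module.finrank ℝ E : ℝ) - 1) * c) ^ (m + 1) / ((m + 1)! : ℝ))) := by
    ring
  rw [e] at htail
  linarith

/-- **THE TWO-SIDED VOLUME LAW** for the model of record at small flow time: with the ceiling of
`Exactness/SphereLOFlowEffectiveActionConcentration` (`KL ≤ |Λ|D²/8`),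
`q^ν·32κ⁴c⁴/(256(d−1)d²(d+2)) ≤ KL((Φ_{0→c})_*π̄ ‖ π̄.tilted(−cS)) ≤ L^ν·(12κ²(2ν)²c²e^{Kc}/(d−1))²/8` —
the reverse relative entropy of the exact LO flow sampler is comparable to (volume)·c⁴ from both sides. -/
theorem torusLink_sublattice_klDiv_two_sided {s q : ℕ} (hL : 4 ≤ L) (hLsq : L = s * q)
    (R : Site ν L × Fin ν → (E ≃ₗᵢ[ℝ] E))
    (hd : 2 ≤ Module.finrank ℝ E) (κ S₀ : ℝ)
    {c : ℝ} (hc0 : 0 ≤ c) (hc : c ≤ |T| + 1) {e : Site ν L → E} (he : ∀ n, ‖e n‖ = 1) (m : ℕ)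
    {g : Site ν L → (Site ν L → sphere (0 : E) 1) → ℝ}
    (hg : ∀ n ω, g n ω = -∫ u in (0 : ℝ)..c, u * (2 * κ ^ 2 / ((Module.finrank ℝ E : ℝ) - 1) *
      ‖tangentKick (localField (linkCoupling (fun ℓ : Site ν L × Fin ν => ℓ.1) (fun ℓ => ℓ.1.shift ℓ.2) R) n
        (sphereTDFlow (G := fun _ : ℝ => loFlowAction κ S₀
          (linkCoupling (fun ℓ : Site ν L × Fin ν => ℓ.1) (fun ℓ => ℓ.1.shift ℓ.2) R))
          (contDiff_const_family (contDiff_loFlowAction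
            (linkCoupling (fun ℓ : Site ν L × Fin ν => ℓ.1) (fun ℓ => ℓ.1.shift ℓ.2) R) κ S₀)) T 0 u
          ((nball (fun k => insert k (couplingNbhd
            (linkCoupling (fun ℓ : Site ν L × Fin ν => ℓ.1) (fun ℓ => ℓ.1.shift ℓ.2) R) k)) (m + 1) n).piecewise
            (fun i => ((ω i : sphere (0 : E) 1) : E)) e)))
        (sphereTDFlow (G := fun _ : ℝ => loFlowAction κ S₀
          (linkCoupling (fun ℓ : Site ν L × Fin ν => ℓ.1) (fun ℓ => ℓ.1.shift ℓ.2) R))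
          (contDiff_const_family (contDiff_loFlowAction
            (linkCoupling (fun ℓ : Site ν L × Fin ν => ℓ.1) (fun ℓ => ℓ.1.shift ℓ.2) R) κ S₀)) T 0 u
          ((nball (fun k => insert k (couplingNbhd
            (linkCoupling (fun ℓ : Site ν L × Fin ν => ℓ.1) (fun ℓ => ℓ.1.shift ℓ.2) R) k)) (m + 1) n).piecewise
            (fun i => ((ω i : sphere (0 : E) 1) : E)) e) n)‖ ^ 2))
    (i₀ : Fin ν) (hs2 : m + 1 + (m + 1) + 2 ≤ s)
    (hc1 : 4 * (2 * (2 * ((m : ℝ) + 1) + 1) ^ ν) ^ 2 *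
        (4 * |κ| ^ 3 * (2 * (ν : ℝ)) ^ 3 / ((Module.finrank ℝ E : ℝ) - 1) ^ 2) ^ 2 * c ^ 2 ≤
      32 * κ ^ 4 /
        (((Module.finrank ℝ E : ℝ) - 1) * (Module.finrank ℝ E : ℝ) ^ 2 * ((Module.finrank ℝ E : ℝ) + 2)) / 16)
    (hc2 : (2 * (2 * ((m : ℝ) + 1) + 1) ^ ν) * (κ ^ 2 * (2 * (ν : ℝ)) ^ 2 / ((Module.finrank ℝ E : ℝ) - 1)) *
      c ^ 2 ≤ 1)
    (hc3 : 32 * κ ^ 4 /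
        (((Module.finrank ℝ E : ℝ) - 1) * (Module.finrank ℝ E : ℝ) ^ 2 * ((Module.finrank ℝ E : ℝ) + 2)) *
      c ^ 4 ≤ 64)
    (hm : 2 ≤ m) (hKc : 3 * |κ| * (2 * (ν : ℝ)) / ((Module.finrank ℝ E : ℝ) - 1) * c ≤ 1)
    (hcA : c ≤ (32 * κ ^ 4 /
        (((Module.finrank ℝ E : ℝ) - 1) * (Module.finrank ℝ E : ℝ) ^ 2 * ((Module.finrank ℝ E : ℝ) + 2))) /
      (1024 * Real.exp 1 * (κ ^ 2 * (2 * (ν : ℝ)) ^ 2 / ((Module.finrank ℝ E : ℝ) - 1)) *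
        (3 * |κ| * (2 * (ν : ℝ)) / ((Module.finrank ℝ E : ℝ) - 1)) ^ 3 * (s : ℝ) ^ ν)) :
    (q : ℝ) ^ ν * (32 * κ ^ 4 /
          (((Module.finrank ℝ E : ℝ) - 1) * (Module.finrank ℝ E : ℝ) ^ 2 * ((Module.finrank ℝ E : ℝ) + 2))) *
        c ^ 4 / 256 ≤
      (klDiv (Measure.map (sphereTDFlowMap (G := fun _ : ℝ => loFlowAction κ S₀
          (linkCoupling (fun ℓ : Site ν L × Fin ν => ℓ.1) (fun ℓ => ℓ.1.shift ℓ.2) R))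
          (contDiff_const_family (contDiff_loFlowAction
            (linkCoupling (fun ℓ : Site ν L × Fin ν => ℓ.1) (fun ℓ => ℓ.1.shift ℓ.2) R) κ S₀)) T 0 c)
          (Measure.pi (fun _ : Site ν L => uniformSphere (volume : Measure E))))
        ((Measure.pi (fun _ : Site ν L => uniformSphere (volume : Measure E))).tilted
          fun ω => -(c * esAction κ S₀
            (linkCoupling (fun ℓ : Site ν L × Fin ν => ℓ.1) (fun ℓ => ℓ.1.shift ℓ.2) R) (fun m => (ω m : E))))).toReal ∧
      (klDiv (Measure.map (sphereTDFlowMap (G := fun _ : ℝ => loFlowAction κ S₀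
          (linkCoupling (fun ℓ : Site ν L × Fin ν => ℓ.1) (fun ℓ => ℓ.1.shift ℓ.2) R))
          (contDiff_const_family (contDiff_loFlowAction
            (linkCoupling (fun ℓ : Site ν L × Fin ν => ℓ.1) (fun ℓ => ℓ.1.shift ℓ.2) R) κ S₀)) T 0 c)
          (Measure.pi (fun _ : Site ν L => uniformSphere (volume : Measure E))))
        ((Measure.pi (fun _ : Site ν L => uniformSphere (volume : Measure E))).tilted
          fun ω => -(c * esAction κ S₀
            (linkCoupling (fun ℓ : Site ν L × Fin ν => ℓ.1) (fun ℓ => ℓ.1.shift ℓ.2) R) (fun m => (ω m : E))))).toReal ≤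
      (L : ℝ) ^ ν * (12 * κ ^ 2 * (2 * (ν : ℝ)) ^ 2 / ((Module.finrank ℝ E : ℝ) - 1) * c ^ 2 *
        Real.exp (3 * |κ| * (2 * (ν : ℝ)) / ((Module.finrank ℝ E : ℝ) - 1) * c)) ^ 2 / 8 := by
  have hL3 : 3 ≤ L := by omega
  refine ⟨torusLink_sublattice_pow_four_le_klDiv_map_loFlow hL hLsq R hd κ S₀ hc0 hc he m hg i₀ hs2 hc1 hc2 hc3
    hm hKc hcA (T := T), ?_⟩
  have hυ := sum_norm_torusLink_le R hL3
  have h := toReal_klDiv_map_loFlow_le_volume (torusLink_self R hL3)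
    (fun m n v w => inner_linkCoupling _ _ R m n v w) hd κ S₀ hυ hc0 hc (T := T)
  have e2 : (Fintype.card (Site ν L) : ℝ) = (L : ℝ) ^ ν := by
    rw [Fintype.card_fun, ZMod.card, Fintype.card_fin]; push_cast; rfl
  rw [e2] at h
  exact h

end Summit.Ventures.LatticeQCDFlow.Exactness

end
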